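import Summits.CriticalPhenomena.CardyFormulaZ2.Theorems.CardyComplexConeSLESixFamiliesGiveCardyDefs
import Summits.CriticalPhenomena.CardyFormulaZ2.Theorems.CardyComplexConeSLESixFamiliesGiveCardySleSideTouchPart1
import Summits.CriticalPhenomena.CardyFormulaZ2.Theorems.CardyComplexConeSLESixFamiliesGiveCardySleSideTouchPart2
import Literature.Probability.RandomPlanarGeometry.ConformalRectangleProofs
import Literature.Probability.RandomPlanarGeometry.MarkedDomainCorners
import HarnessLib

/-!
# SLE₆ side-arc touch law (`stub_sleSideTouch`)

Final file of the registered stub `stub_sleSideTouch : SleSideTouch` of the line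
`collar-touch-sandwich` of crux `SLESixFamiliesGiveCardy` (stmt-CriticalPhenomena-9654): for a
conformal rectangle `Q = (p₀, p₁, p₂, p₃)` with uniformizing datum `(φ, x)`,
(U) every chordal SLE₆ random curve in `Q.chord 0 1` touches the closed `η`-neighbourhood of the
far arc `Q.arc 2 = (p₂p₃)` with probability `→ F(crossRatio x)` as `η → 0⁺`, and
(L) every chordal SLE₆ random curve in `Q.chord 0 3` touches the closed `η`-neighbourhood of
`Q.arc 1 = (p₁p₂)` with probability `→ 1 - F(crossRatio x)`.

Proof. (1) Continuity from above: the events `hitsBefore (cthickening η A) ∅` ("the trace meets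
`cthickening η A`") decrease, as `η ↓ 0`, to `hitsBefore A ∅` (compact traces, closed `A`), so
their probabilities converge (`tendsto_measureReal_hitsBefore_cthickening`). (2) Transport to `ℍ`:
a.s. the curve is the class of the time-compactified image of the SLE₆ trace under the boundary
extension `Ψ` of a chordal map `ψ`; by the boundary correspondence on the period window of the
target parameter (Part 2) the arc pulls back to a compact real segment `uIcc u v` off `0` whose end
points are boundary preimages of two corners, so the range event is "the trace meets `uIcc u v`"
(`mk_mem_hitsBefore_empty_iff`), of probability `1 - F(min |u| |v|/max |u| |v|)` by the half-plane
touch law at `κ = 6` (Part 1, Rohde–Schramm Lemma 6.6 in Cardy's normalisation). (3) Cross-ratio: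
an explicit real Möbius map turns `ψ` into a uniformizing datum of cross-ratio `(u₂ - u₃)/u₂`
(reading U) resp. `v₁/v₂` (reading L) (Part 2), equal to `crossRatio x` by conformal invariance
(`ConformalRectangle.crossRatio_eq_of_isUniformizing_holds`); Cardy duality `F(1 - η) = 1 - F(η)`
finishes reading (U).
-/

noncomputable section

open Set Filter Topology Metric MeasureTheory Complex
open scoped NNReal unitInterval
open UpperHalfPlane (upperHalfPlaneSet)
open Literature.Probability Literature.Probability.RandomPlanarGeometry

namespace Summit.CriticalPhenomena.CardyFormulaZ2.Cruxes.SLESixFamiliesGiveCardy.CollarTouchSandwich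

/-! ### Continuity from above in the thickening parameter -/

/-- The events "the trace meets `cthickening η A`" decrease to "the trace meets `A`" as `η ↓ 0`
(`A` closed, traces compact): `⋂_{η > 0} hitsBefore (cthickening η A) ∅ = hitsBefore A ∅`. -/
theorem iInter_hitsBefore_cthickening {A : Set ℂ} (hA : IsClosed A) :
    ⋂ η > (0 : ℝ), CurveClass.hitsBefore (cthickening η A) (∅ : Set ℂ) =
      CurveClass.hitsBefore A (∅ : Set ℂ) := by
  ext c
  simp only [CurveClass.hitsBefore_empty_right, mem_iInter, mem_compl_iff,
    CurveClass.mem_rangeSubset]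
  constructor
  · intro hall hsub
    have hdisj : Disjoint c.range A := subset_compl_iff_disjoint_right.1 hsub
    obtain ⟨δ, hδ, hδdisj⟩ := hdisj.exists_cthickenings c.isCompact_range hA
    refine hall δ hδ fun p hp hpA ↦ ?_
    exact hδdisj.ne_of_mem (self_subset_cthickening _ hp) hpA rfl
  · intro h η hη hsub
    exact h (fun p hp hpA ↦ hsub hp (self_subset_cthickening A hpA))

/-- **Continuity from above**: for a finite measure `μ` on curve classes and a closed set `A`,
`μ (trace meets cthickening η A) → μ (trace meets A)` as `η → 0⁺`. -/
theorem tendsto_measureReal_hitsBefore_cthickening (μ : Measure (CurveClass ℂ)) [IsFiniteMeasure μ]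
    {A : Set ℂ} (hA : IsClosed A) :
    Tendsto (fun η : ℝ ↦ μ.real (CurveClass.hitsBefore (cthickening η A) (∅ : Set ℂ)))
      (𝓝[>] 0) (𝓝 (μ.real (CurveClass.hitsBefore A (∅ : Set ℂ)))) := by
  have h := tendsto_measure_biInter_gt (μ := μ)
    (s := fun η : ℝ ↦ CurveClass.hitsBefore (cthickening η A) (∅ : Set ℂ)) (a := 0)
    (fun r _ ↦ (CurveClass.isClosed_hitsBefore_empty_right isClosed_cthickening).measurableSet
      |>.nullMeasurableSet)
    (fun i j _ hij c hc ↦ ?_) ⟨1, one_pos, measure_ne_top _ _⟩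
  · rw [iInter_hitsBefore_cthickening hA] at h
    exact (ENNReal.tendsto_toReal (measure_ne_top _ _)).comp h
  · simp only [CurveClass.hitsBefore_empty_right, mem_compl_iff, CurveClass.mem_rangeSubset] at hc ⊢
    exact fun hsub ↦ hc fun p hp hpA ↦ hsub hp (cthickening_mono hij A hpA)

/-! ### The range event of an SLE curve through the chordal map -/

/-- **The probability of the range event of an SLE₆ curve, read in the half-plane.** If `Γ` is a
chordal SLE₆ curve in the Dobrushin domain `D` transported by the chordal map `ψ`, the end point
`D.pt 1` is off the closed set `A`, and `Ψ z ∈ A ↔ z ∈ uIcc u v ⊆ ℝ` on the closed half-plane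
for reals `u ≠ v` of the same sign, then `P[Γ meets A] = 1 - F(min |u| |v| / max |u| |v|)`. -/
theorem measureReal_map_hitsBefore_eq {D : DobrushinDomain} {Γ : (ℝ≥0 → ℝ) → CurveClass ℂ}
    (hΓm : AEMeasurable Γ Process.preWienerMeasure) {ψ : ConformalEquiv upperHalfPlaneSet D.carrier}
    (hae : ∀ᵐ ω ∂Process.preWienerMeasure,
      Loewner.IsGeneratedByCurve (sleDriving 6 ω) (sleTrace 6 ω) ∧
        ∃ c : Curve ℂ, Γ ω = CurveClass.mk c ∧
          IsCompactifiedImage ψ.boundaryExtension (sleTrace 6 ω) (D.pt 1) c)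
    {A : Set ℂ} (hA : IsClosed A) (hb : D.pt 1 ∉ A) {u v : ℝ} (huv : 0 < u * v) (hne : u ≠ v)
    (hΨA : ∀ z : ℂ, 0 ≤ z.im → (ψ.boundaryExtension z ∈ A ↔ z.im = 0 ∧ z.re ∈ uIcc u v)) :
    (Process.preWienerMeasure.map Γ).real (CurveClass.hitsBefore A (∅ : Set ℂ)) =
      1 - cardyFunction (min |u| |v| / max |u| |v|) := by
  rw [measureReal_def, Measure.map_apply_of_aemeasurable hΓm
    (CurveClass.isClosed_hitsBefore_empty_right hA).measurableSet, ← measureReal_def,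
    ← sleSix_touch_uIcc u v huv hne]
  refine measureReal_congr ?_
  filter_upwards [hae] with ω ⟨hgen, c, hΓc, hc⟩
  refine propext ?_
  change Γ ω ∈ CurveClass.hitsBefore A ∅ ↔ ∃ r : ℝ, r ∈ uIcc u v ∧ (r : ℂ) ∈ range (sleTrace 6 ω)
  rw [hΓc]
  exact mk_mem_hitsBefore_empty_iff (fun t ↦ hΨA _ (hgen.im_nonneg t)) hb hc

/-! ### Reading (U): SLE₆ in `Q.chord 0 1` touching `Q.arc 2` -/

/-- **Reading (U)**: for every chordal SLE₆ curve `Γ` in `Q.chord 0 1`,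
`P[Γ meets Q.arc 2] = F(crossRatio x)` for every uniformizing datum `(φ, x)` of `Q`. -/
theorem measureReal_map_hitsBefore_arc_two {Q : ConformalRectangle}
    {φ : ConformalEquiv upperHalfPlaneSet Q.carrier} {x : Fin 4 → ℝ} (hφx : Q.IsUniformizing φ x)
    {Γ : (ℝ≥0 → ℝ) → CurveClass ℂ} (hΓ : IsSLECurve 6 (Q.chord 0 1 (by decide)) Γ) :
    (Process.preWienerMeasure.map Γ).real (CurveClass.hitsBefore (Q.arc 2) (∅ : Set ℂ)) =
      cardyFunction (crossRatio x) := by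
  obtain ⟨hΓm, ψ, hψ, hae⟩ := hΓ
  obtain ⟨Φ, h⟩ := JordanDomain.exists_isDiscExtension (D := Q.toJordanDomain)
    JordanDomain.exists_continuousOn_extension_holds ψ
  have h₀ : ψ.HasBoundaryValue 0 (Q.boundary (Q.mark 0)) := hψ.1
  have hτ : ψ.HasBoundaryValueAtInfty (Q.boundary (Q.mark 1)) := hψ.2
  -- the window `(mark 1 - 1, mark 1)` contains `mark 2 - 1 < mark 3 - 1 < mark 0`
  have h01 : Q.mark 0 < Q.mark 1 := Q.strictMono_mark (by decide)
  have h12 : Q.mark 1 < Q.mark 2 := Q.strictMono_mark (by decide)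
  have h23 : Q.mark 2 < Q.mark 3 := Q.strictMono_mark (by decide)
  have hm0 := (Q.mark_mem 0).1
  have hm3 := (Q.mark_mem 3).2
  have ht₀ : Q.mark 0 ∈ Ioo (Q.mark 1 - 1) (Q.mark 1) := ⟨by linarith, h01⟩
  have hα : Q.mark 1 - 1 < Q.mark 2 - 1 := by linarith
  have hαβ : Q.mark 2 - 1 < Q.mark 3 - 1 := by linarith
  have hβ : Q.mark 3 - 1 < Q.mark 0 := by linarith
  set u₂ := JordanDomain.discParam Q.toJordanDomain Φ (Q.mark 2 - 1) with hu₂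
  set u₃ := JordanDomain.discParam Q.toJordanDomain Φ (Q.mark 3 - 1) with hu₃
  have hord := discParam_order_of_lt_left h hτ ht₀ h₀ hα hαβ hβ
  rw [← hu₂, ← hu₃] at hord
  have huv : 0 < u₂ * u₃ := by
    rcases hord with ⟨h1, h2⟩ | ⟨h1, h2⟩
    · exact mul_pos_of_neg_of_neg (h1.trans h2) h2
    · exact mul_pos (h1.trans h2) h1
  have hne : u₂ ≠ u₃ := by rcases hord with ⟨h1, -⟩ | ⟨-, h2⟩ <;> [exact h1.ne; exact h2.ne']
  -- the range event read in `ℍ`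
  have hΨA : ∀ z : ℂ, 0 ≤ z.im → (ψ.boundaryExtension z ∈ Q.arc 2 ↔ z.im = 0 ∧ z.re ∈ uIcc u₂ u₃) := by
    intro z hz
    rw [ConformalRectangle.arc_two_eq']
    exact boundaryExtension_mem_image_Icc_iff h hτ hα hαβ.le (hβ.trans ht₀.2) hz
  have hb : (Q.chord 0 1 (by decide)).pt 1 ∉ Q.arc 2 := by
    rw [MarkedDomain.pt_chord_one, Q.pt_mem_arc_iff]; decide
  rw [measureReal_map_hitsBefore_eq hΓm hae (Q.isClosed_arc 2) hb huv hne hΨA]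
  -- the cross-ratio
  have hb2 : ψ.HasBoundaryValue u₂ (Q.pt 2) := by
    have := hasBoundaryValue_discParam_window h hτ (t := Q.mark 2 - 1) ⟨hα, by linarith⟩
    rwa [Q.periodic_boundary.sub_eq] at this
  have hb3 : ψ.HasBoundaryValue u₃ (Q.pt 3) := by
    have := hasBoundaryValue_discParam_window h hτ (t := Q.mark 3 - 1) ⟨hα.trans hαβ, by linarith⟩
    rwa [Q.periodic_boundary.sub_eq] at this
  obtain ⟨φ₀, x₀, hφ₀, hcr⟩ := exists_isUniformizing_crossRatio_eq_U ψ h₀ hτ hb2 hb3 hord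
  rw [ConformalRectangle.crossRatio_eq_of_isUniformizing_holds hφx hφ₀, hcr]
  -- `min |u₂| |u₃| / max |u₂| |u₃| = u₃ / u₂` and Cardy duality
  have hratio : min |u₂| |u₃| / max |u₂| |u₃| = u₃ / u₂ := by
    rcases hord with ⟨h1, h2⟩ | ⟨h1, h2⟩
    · rw [abs_of_neg (h1.trans h2), abs_of_neg h2, min_eq_right (by linarith),
        max_eq_left (by linarith), neg_div_neg_eq]
    · rw [abs_of_pos (h1.trans h2), abs_of_pos h1, min_eq_right h2.le, max_eq_left h2.le]
  have hmem : u₃ / u₂ ∈ Icc (0 : ℝ) 1 := by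
    rcases hord with ⟨h1, h2⟩ | ⟨h1, h2⟩
    · exact ⟨div_nonneg_of_nonpos h2.le (h1.trans h2).le, (div_le_one_of_neg (h1.trans h2)).2 h1.le⟩
    · exact ⟨div_nonneg h1.le (h1.trans h2).le, (div_le_one (h1.trans h2)).2 h2.le⟩
  have hu₂0 : u₂ ≠ 0 := by rcases hord with ⟨h1, h2⟩ | ⟨h1, h2⟩ <;> [exact (h1.trans h2).ne; exact (h1.trans h2).ne']
  rw [hratio, show (u₂ - u₃) / u₂ = 1 - u₃ / u₂ by field_simp, cardyFunction_one_sub_holds hmem]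

/-! ### Reading (L): SLE₆ in `Q.chord 0 3` touching `Q.arc 1` -/

/-- **Reading (L)**: for every chordal SLE₆ curve `Γ` in `Q.chord 0 3`,
`P[Γ meets Q.arc 1] = 1 - F(crossRatio x)` for every uniformizing datum `(φ, x)` of `Q`. -/
theorem measureReal_map_hitsBefore_arc_one {Q : ConformalRectangle}
    {φ : ConformalEquiv upperHalfPlaneSet Q.carrier} {x : Fin 4 → ℝ} (hφx : Q.IsUniformizing φ x)
    {Γ : (ℝ≥0 → ℝ) → CurveClass ℂ} (hΓ : IsSLECurve 6 (Q.chord 0 3 (by decide)) Γ) :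
    (Process.preWienerMeasure.map Γ).real (CurveClass.hitsBefore (Q.arc 1) (∅ : Set ℂ)) =
      1 - cardyFunction (crossRatio x) := by
  obtain ⟨hΓm, ψ, hψ, hae⟩ := hΓ
  obtain ⟨Φ, h⟩ := JordanDomain.exists_isDiscExtension (D := Q.toJordanDomain)
    JordanDomain.exists_continuousOn_extension_holds ψ
  have h₀ : ψ.HasBoundaryValue 0 (Q.boundary (Q.mark 0)) := hψ.1
  have hτ : ψ.HasBoundaryValueAtInfty (Q.boundary (Q.mark 3)) := hψ.2
  -- the window `(mark 3 - 1, mark 3)` contains `mark 0 < mark 1 < mark 2`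
  have h01 : Q.mark 0 < Q.mark 1 := Q.strictMono_mark (by decide)
  have h12 : Q.mark 1 < Q.mark 2 := Q.strictMono_mark (by decide)
  have h23 : Q.mark 2 < Q.mark 3 := Q.strictMono_mark (by decide)
  have hm0 := (Q.mark_mem 0).1
  have hm3 := (Q.mark_mem 3).2
  have ht₀ : Q.mark 0 ∈ Ioo (Q.mark 3 - 1) (Q.mark 3) := ⟨by linarith, by linarith⟩
  set v₁ := JordanDomain.discParam Q.toJordanDomain Φ (Q.mark 1) with hv₁
  set v₂ := JordanDomain.discParam Q.toJordanDomain Φ (Q.mark 2) with hv₂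
  have hord := discParam_order_of_lt_right h hτ ht₀ h₀ h01 h12 h23
  rw [← hv₁, ← hv₂] at hord
  have huv : 0 < v₁ * v₂ := by
    rcases hord with ⟨h1, h2⟩ | ⟨h1, h2⟩
    · exact mul_pos h1 (h1.trans h2)
    · exact mul_pos_of_neg_of_neg h2 (h1.trans h2)
  have hne : v₁ ≠ v₂ := by rcases hord with ⟨-, h2⟩ | ⟨h1, -⟩ <;> [exact h2.ne; exact h1.ne']
  have hΨA : ∀ z : ℂ, 0 ≤ z.im → (ψ.boundaryExtension z ∈ Q.arc 1 ↔ z.im = 0 ∧ z.re ∈ uIcc v₁ v₂) := by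
    intro z hz
    rw [ConformalRectangle.arc_one_eq]
    exact boundaryExtension_mem_image_Icc_iff h hτ (ht₀.1.trans h01) h12.le h23 hz
  have hb : (Q.chord 0 3 (by decide)).pt 1 ∉ Q.arc 1 := by
    rw [MarkedDomain.pt_chord_one, Q.pt_mem_arc_iff]; decide
  rw [measureReal_map_hitsBefore_eq hΓm hae (Q.isClosed_arc 1) hb huv hne hΨA]
  have hb1 : ψ.HasBoundaryValue v₁ (Q.pt 1) :=
    hasBoundaryValue_discParam_window h hτ (t := Q.mark 1) ⟨ht₀.1.trans h01, h12.trans h23⟩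
  have hb2 : ψ.HasBoundaryValue v₂ (Q.pt 2) :=
    hasBoundaryValue_discParam_window h hτ (t := Q.mark 2) ⟨ht₀.1.trans (h01.trans h12), h23⟩
  obtain ⟨φ₀, x₀, hφ₀, hcr⟩ := exists_isUniformizing_crossRatio_eq_L ψ h₀ hb1 hb2 hτ hord
  rw [ConformalRectangle.crossRatio_eq_of_isUniformizing_holds hφx hφ₀, hcr]
  have hratio : min |v₁| |v₂| / max |v₁| |v₂| = v₁ / v₂ := by
    rcases hord with ⟨h1, h2⟩ | ⟨h1, h2⟩
    · rw [abs_of_pos h1, abs_of_pos (h1.trans h2), min_eq_left h2.le, max_eq_right h2.le]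
    · rw [abs_of_neg h2, abs_of_neg (h1.trans h2), min_eq_left (by linarith),
        max_eq_right (by linarith), neg_div_neg_eq]
  rw [hratio]

/-! ### The stub -/

/-- **STATEMENT D of the line `collar-touch-sandwich` — the SLE₆ side-arc touch law.** For a
conformal rectangle `Q` with uniformizing datum `(φ, x)`: (U) every chordal SLE₆ curve in
`Q.chord 0 1` touches the closed `η`-neighbourhood of `Q.arc 2` with probability tending to
`F(crossRatio x)` as `η → 0⁺`; (L) every chordal SLE₆ curve in `Q.chord 0 3` touches the closed
`η`-neighbourhood of `Q.arc 1` with probability tending to `1 - F(crossRatio x)`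
(Rohde–Schramm (2005), Lemma 6.6 at `κ = 6`, Carathéodory boundary correspondence, conformal
invariance of the cross-ratio, Cardy duality). -/
theorem stub_sleSideTouch : SleSideTouch := by
  intro Q φ x hφx
  haveI := isProbabilityMeasure_preWienerMeasure'
  constructor
  · intro Γ hΓ
    haveI : IsProbabilityMeasure (Process.preWienerMeasure.map Γ) :=
      Measure.isProbabilityMeasure_map hΓ.aemeasurable
    have h := tendsto_measureReal_hitsBefore_cthickening (Process.preWienerMeasure.map Γ)
      (Q.isClosed_arc 2)
    rwa [measureReal_map_hitsBefore_arc_two hφx hΓ] at h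
  · intro Γ hΓ
    haveI : IsProbabilityMeasure (Process.preWienerMeasure.map Γ) :=
      Measure.isProbabilityMeasure_map hΓ.aemeasurable
    have h := tendsto_measureReal_hitsBefore_cthickening (Process.preWienerMeasure.map Γ)
      (Q.isClosed_arc 1)
    rwa [measureReal_map_hitsBefore_arc_one hφx hΓ] at h

end Summit.CriticalPhenomena.CardyFormulaZ2.Cruxes.SLESixFamiliesGiveCardy.CollarTouchSandwich
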